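import Literature.NumberTheory.ComplexMultiplication.FiniteQAlgebraLatticeWeakEquivalence
import Mathlib.Algebra.TrivSqZeroExt.Basic
import HarnessLib

/-!
# FULL LATTICES OF `A = ℚ1_A ⊕ R` WITH `R² = 0`: every full lattice contains a unit `u` with `u⁻¹L` an ORDER, so every
# `ε`-class contains an order and every full lattice is invertible; the orders are exactly `ℤ1_A ⊕ K`, `K ⊆ R`, and
# multiply by `(ℤ1_A ⊕ K)(ℤ1_A ⊕ K′) = ℤ1_A ⊕ (K + K′)` — Hertling–Larabi 2026b Lemma 12.1 (`A = ℚ[x,y]/(x²,xy,y²)`) in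
# the generality of an arbitrary square-zero radical (`A = TrivSqZeroExt ℚ M`, e.g. `ℚ[x]/(x²)`, `ℚ[x,y]/(x,y)²`, …)

[topic NumberTheory/ComplexMultiplication] General-`A` series (namespace
`Literature.NumberTheory.ComplexMultiplication.FiniteQAlgebraLattice`); sequel of `FiniteQAlgebraLatticeWeakEquivalence`
(`units_smul_mul`, `units_smul_mul_units_smul`, `div_self_units_smul`, `units_smul_mul_div_div_eq`) and of
`FiniteQAlgebraLatticePowersInvertible` (`mul_self_eq_of_one_mem`, `div_self_eq_of_one_mem`,
`mul_div_div_eq_of_one_mem_of_mul_le`) — REUSED by name.  Lane `lit-hodgefound` (Track 2 foundations library), seat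
p19 generation 37, row g37-#5.  THEOREMS ONLY: no definition, no instance, no notation, no named fact (D-0026, net
Literature debt `0`), no `sorry`.

DEF-FREE SPELLING.  «`A = F ⊕ R` with `F = ℚ1_A` and `R² = 0`» is carried by an AUGMENTATION `π : A →ₐ[ℚ] ℚ` (the
projection `pr_F`, cf. HL 2026 Rem. 3.2 (ii) ∕ Lemma 9.1) whose kernel has square zero:
`∀ x y, π x = 0 → π y = 0 → x·y = 0`; `R = ker π`.  «`L` is an order» = `1 ∈ L ∧ L·L ⊆ L`; `[L]_ε ∋` an order =
`∃ u ∈ A^{unit}, u ∈ L ∧ u⁻¹L is an order`; the coordinate `β_{11}` of HL's normal form is the generator `g` of the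
cyclic group `π(L) ⊂ ℚ`.

## Source, VERBATIM

C. Hertling, K. Larabi, *Conjugacy classes of regular integer matrices*, arXiv:2602.15748 (2026) [HertlingLarabi2026b],
held `paper:arxiv-2602.15748`, §12 (chunk p0041): «All 3-dimensional algebras except one are cyclic […] The exception
is the algebra `ℚ[x,y]/(x², xy, y²)`. […] **Lemma 12.1.** Let `A` by the algebra `A = ℚ1_A ⊕ ℚa ⊕ ℚb` with
`a² = ab = b² = 0` (it is isomorphic to `ℚ[x,y]/(x²,xy,y²)`). Then `A = F ⊕ R` with `F = ℚ1_A` and `R = ℚa ⊕ ℚb`. Each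
full lattice is invertible. Each `ε`-class of full lattices contains an order. The orders are the full lattices
`ℤ1_A ⊕ K` with `K ∈ 𝓛(R)`. Therefore the semigroup `𝓔(A)` is `𝓔(A) = W(𝓔(A)) ≅ ({orders}, ·) ≅ (𝓛(R), +)`.
**Proof:** Each full lattice `L ∈ 𝓛(A)` has a unique `ℤ`-basis of the shape `(1_A, a, b)·(β_{ij})` [lower
triangular] with `β_{11}, β_{22}, β_{33} ∈ ℚ_{>0}`, `β_{ij} ∈ (−½β_{ii}, ½β_{ii}] ∩ ℚ` for `i > j`. The first basis
element `u := β_{11}1_A + β_{21}a + β_{31}b` is in `A^{unit}`. The full lattice `L` is an order if and only if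
`u = 1_A`. The full lattice `u⁻¹L` is an order. The remaining statements are clear, too. □»  HL 2026
(arXiv:2602.14973, §6, after Thm. 6.4): «This extension of the Jordan-Zassenhaus theorem in Theorem 6.5 […] In the case
of an algebra `A` with radical `R` with `R² = 0` it was proved by Faddeev [Fa67].»

## What is proved (`π : A →ₐ[ℚ] ℚ` with square-zero kernel; `L, Λ, K : Submodule ℤ A`)

* §1 the unit group: `isUnit_of_map_ne_zero` ∕ **`isUnit_iff_map_ne_zero`** («`u := β_{11}1_A + ⋯` is in `A^{unit}`»:
  `A^{unit} = π⁻¹(ℚ^×)`), and the multiplication rule `mul_eq_of_map_eq` (`xy = π(y)x + π(x)y − π(x)π(y)1_A`).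
* §2 the augmentation image: `exists_map_eq_span_singleton` (`π(L) = ℤg` for finitely generated `L`),
  `exists_mem_map_ne_zero` (`π(L) ≠ 0` for full `L`), `exists_intCast_eq_map_of_one_mem` (`π(Λ) = ℤ` for an order).
* §3 **`exists_units_mem_isOrder_inv_smul`** («Each `ε`-class of full lattices contains an order»: a unit `u ∈ L` with
  `1 ∈ u⁻¹L`, `u⁻¹L·u⁻¹L ⊆ u⁻¹L`), **`mul_div_div_eq_of_sq_zero`** («Each full lattice is invertible») with
  `div_self_eq_inv_smul` (`𝒪(L) = u⁻¹L`).
* §4 the orders: **`eq_span_one_sup_inf_ker`** («The orders are the full lattices `ℤ1_A ⊕ K` with `K ∈ 𝓛(R)`»: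
  `Λ = ℤ1_A + (Λ ∩ R)`), `isOrder_span_one_sup` (every `ℤ1_A + K`, `K ⊆ R`, is multiplicatively closed with `1`),
  **`span_one_sup_mul_span_one_sup`** (`(ℤ1_A + K)(ℤ1_A + K′) = ℤ1_A + (K + K′)`: «`({orders}, ·) ≅ (𝓛(R), +)`»), and
  `eq_of_units_smul_eq_of_isOrder` (`ε`-equivalent orders are equal: «`𝓔(A) ≅ {orders}`»).
* §5 the model `TrivSqZeroExt ℚ M` (`= ℚ1 ⊕ M`, `M·M = 0`; `M = ℚ²` is HL's `ℚ[x,y]/(x²,xy,y²)`, `M = ℚ` is `ℚ[x]/(x²)`):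
  `trivSqZeroExt_mul_eq_zero_of_fst_eq_zero` (the hypothesis of §§1–4 for `π = fstHom`),
  `exists_units_mem_isOrder_inv_smul_trivSqZeroExt`, `mul_div_div_eq_trivSqZeroExt`.
NOT here: HL's normal-form basis `(β_{ij})` itself (only its first column is needed), the finiteness statements of
HL 2026 Thm. 6.5 [Fa67].

## References
* [HertlingLarabi2026b] C. Hertling, K. Larabi, arXiv:2602.15748 (2026), §12 Lemma 12.1 with proof (chunk p0041).
  [cite: HertlingLarabi2026b, §12 Lemma 12.1, chunk p0041]
* [HertlingLarabi2026] C. Hertling, K. Larabi, arXiv:2602.14973 (2026), §3 Rem. 3.2 (ii) (`A = F ⊕ R`, `pr_F`), §6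
  (the case `R² = 0` [Fa67]). [cite: HertlingLarabi2026, §6 remark before Thm. 6.5, chunk p0015]
-/

noncomputable section

open scoped Pointwise nonZeroDivisors
open Module Function Submodule

open Literature.NumberTheory.Automorphic (IsFullLattice mem_units_smul_submodule_iff)

namespace Literature.NumberTheory.ComplexMultiplication.FiniteQAlgebraLattice

section SquareZeroRadical

variable {A : Type} [CommRing A] [Algebra ℚ A]

/-! ## §1 The units of `A = ℚ1_A ⊕ R`, `R² = 0`, and the multiplication rule -/

/-- **`xy = π(y)x + π(x)y − π(x)π(y)·1_A` when `(ker π)² = 0`** (`(x − π(x)1)(y − π(y)1) = 0`).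
[cite: HertlingLarabi2026b, §12 Lemma 12.1 («`a² = ab = b² = 0`»), chunk p0041] -/
theorem mul_eq_of_map_eq (π : A →ₐ[ℚ] ℚ) (hR : ∀ x y : A, π x = 0 → π y = 0 → x * y = 0) (x y : A) :
    x * y = π y • x + π x • y - (π x * π y) • (1 : A) := by
  have h := hR (x - π x • (1 : A)) (y - π y • (1 : A)) (by simp) (by simp)
  simp only [Algebra.smul_def, mul_one, map_mul] at h ⊢
  linear_combination h

/-- **«The first basis element `u := β_{11}1_A + β_{21}a + β_{31}b` is in `A^{unit}`»: every `u` with `π(u) ≠ 0` is a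
unit**, with inverse `π(u)⁻¹1_A − π(u)⁻²(u − π(u)1_A)`. [cite: HertlingLarabi2026b, §12 Lemma 12.1 (proof), chunk p0041] -/
theorem isUnit_of_map_ne_zero (π : A →ₐ[ℚ] ℚ) (hR : ∀ x y : A, π x = 0 → π y = 0 → x * y = 0) {u : A}
    (hu : π u ≠ 0) : IsUnit u := by
  set c : A := algebraMap ℚ A (π u) with hc'
  set c' : A := algebraMap ℚ A (π u)⁻¹ with hc''
  have hc : c * c' = 1 := by rw [hc', hc'', ← map_mul, mul_inv_cancel₀ hu, map_one]
  have hr : (u - c) * (u - c) = 0 := hR _ _ (by simp [hc']) (by simp [hc'])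
  refine IsUnit.of_mul_eq_one (c' - c' * c' * (u - c)) ?_
  linear_combination (-(c' * c')) * hr + (c * c' + 1 - c' * u) * hc

/-- **`A^{unit} = π⁻¹(ℚ ∖ 0)`.** [cite: HertlingLarabi2026b, §12 Lemma 12.1 (proof), chunk p0041] -/
theorem isUnit_iff_map_ne_zero (π : A →ₐ[ℚ] ℚ) (hR : ∀ x y : A, π x = 0 → π y = 0 → x * y = 0) {u : A} :
    IsUnit u ↔ π u ≠ 0 :=
  ⟨fun h => (h.map π).ne_zero, isUnit_of_map_ne_zero π hR⟩

/-! ## §2 The augmentation image `π(L) ⊂ ℚ` -/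

/-- **`π(L) = ℤg` for a finitely generated `L`** (a finitely generated subgroup of `ℚ` is cyclic — HL's `β_{11}`).
[cite: HertlingLarabi2026b, §12 Lemma 12.1 (proof: «`β_{11} ∈ ℚ_{>0}`»), chunk p0041] -/
theorem exists_map_eq_span_singleton (π : A →ₐ[ℚ] ℚ) {L : Submodule ℤ A} (hL : L.FG) :
    ∃ g : ℚ, L.map (π.toLinearMap.restrictScalars ℤ) = span ℤ {g} := by
  classical
  set J : Submodule ℤ ℚ := L.map (π.toLinearMap.restrictScalars ℤ) with hJ
  have hJfg : J.FG := hL.map _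
  let Jf : FractionalIdeal ℤ⁰ ℚ := ⟨J, FractionalIdeal.isFractional_of_fg hJfg⟩
  haveI hJp : (J : Submodule ℤ ℚ).IsPrincipal := FractionalIdeal.isPrincipal Jf
  exact ⟨Submodule.IsPrincipal.generator J, (Submodule.IsPrincipal.span_singleton_generator J).symm⟩

omit [Algebra ℚ A] in
/-- A full lattice contains `n·1_A` for some integer `n ≠ 0` (file-local). [folklore] -/
private theorem exists_ne_zero_zsmul_one_mem {L : Submodule ℤ A} (hL : IsFullLattice A L) :
    ∃ n : ℤ, n ≠ 0 ∧ n • (1 : A) ∈ L :=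
  hL.2 1

/-- **`π(L) ≠ 0` for a full lattice** (`n·1_A ∈ L` with `n ≠ 0`). [cite: HertlingLarabi2026b, §12 Lemma 12.1 (proof: «`β_{11} ∈ ℚ_{>0}`»), chunk p0041] -/
theorem exists_mem_map_ne_zero (π : A →ₐ[ℚ] ℚ) {L : Submodule ℤ A} (hL : IsFullLattice A L) :
    ∃ x ∈ L, π x ≠ 0 := by
  obtain ⟨n, hn, hnL⟩ := exists_ne_zero_zsmul_one_mem hL
  refine ⟨_, hnL, ?_⟩
  rw [map_zsmul, map_one, zsmul_eq_mul, mul_one]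
  exact_mod_cast hn

/-- **`π(Λ) = ℤ` for an order** (a finitely generated subring `ℤg` of `ℚ` with `1 ∈ ℤg` is `ℤ`): every `π(x)`,
`x ∈ Λ`, is an integer. [cite: HertlingLarabi2026b, §12 Lemma 12.1 («`L` is an order if and only if `u = 1_A`»), chunk p0041] -/
theorem exists_intCast_eq_map_of_one_mem (π : A →ₐ[ℚ] ℚ) {Λ : Submodule ℤ A} (hΛ : Λ.FG) (h1 : (1 : A) ∈ Λ)
    (hΛΛ : Λ * Λ ≤ Λ) {x : A} (hx : x ∈ Λ) : ∃ m : ℤ, (m : ℚ) = π x := by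
  obtain ⟨g, hg⟩ := exists_map_eq_span_singleton π hΛ
  have hmem : ∀ y ∈ Λ, π y ∈ span ℤ {g} := fun y hy => by
    rw [← hg]; exact Submodule.mem_map_of_mem hy
  -- `1 = kg`, `g² = jg`
  obtain ⟨k, hk⟩ := mem_span_singleton.1 (hmem 1 h1)
  rw [map_one] at hk
  have hg0 : g ≠ 0 := fun h => by rw [h, smul_zero] at hk; exact zero_ne_one hk
  have hgΛ : g ∈ Λ.map (π.toLinearMap.restrictScalars ℤ) := by rw [hg]; exact mem_span_singleton_self g
  obtain ⟨y, hy, hyg⟩ := Submodule.mem_map.1 hgΛ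
  have hyg' : π y = g := hyg
  obtain ⟨j, hj⟩ := mem_span_singleton.1 (hmem (y * y) (hΛΛ (mul_mem_mul hy hy)))
  rw [map_mul, hyg'] at hj
  -- `g = j ∈ ℤ`
  have hgj : g = j := by
    have h := hj
    rw [zsmul_eq_mul] at h
    exact mul_right_cancel₀ hg0 h.symm
  obtain ⟨m, hm⟩ := mem_span_singleton.1 (hmem x hx)
  exact ⟨m * j, by rw [← hm, zsmul_eq_mul, hgj, Int.cast_mul]⟩

/-! ## §3 Every `ε`-class contains an order; every full lattice is invertible -/

/-- **LEMMA 12.1: «Each `ε`-class of full lattices contains an order»** — for `(ker π)² = 0` every full lattice `L`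
contains a unit `u` (any `u ∈ L` with `π(u)` generating `π(L)`) such that `u⁻¹L` is an ORDER: `1_A ∈ u⁻¹L` and
`u⁻¹L·u⁻¹L ⊆ u⁻¹L` («The full lattice `u⁻¹L` is an order»: `π(u⁻¹L) = ℤ` and `xy = π(y)x + π(x)y − π(x)π(y)1_A`).
[cite: HertlingLarabi2026b, §12 Lemma 12.1 with proof, chunk p0041] -/
theorem exists_units_mem_isOrder_inv_smul (π : A →ₐ[ℚ] ℚ) (hR : ∀ x y : A, π x = 0 → π y = 0 → x * y = 0)
    {L : Submodule ℤ A} (hL : IsFullLattice A L) :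
    ∃ u : Aˣ, (u : A) ∈ L ∧ (1 : A) ∈ u⁻¹ • L ∧ (u⁻¹ • L) * (u⁻¹ • L) ≤ u⁻¹ • L := by
  obtain ⟨g, hg⟩ := exists_map_eq_span_singleton π hL.1
  have hmem : ∀ y ∈ L, π y ∈ span ℤ {g} := fun y hy => by
    rw [← hg]; exact Submodule.mem_map_of_mem hy
  -- `u ∈ L` with `π(u) = g ≠ 0`
  have hgL : g ∈ L.map (π.toLinearMap.restrictScalars ℤ) := by rw [hg]; exact mem_span_singleton_self g
  obtain ⟨u₀, hu₀, hu₀g⟩ := Submodule.mem_map.1 hgL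
  have hu₀g' : π u₀ = g := hu₀g
  have hg0 : g ≠ 0 := by
    obtain ⟨x, hx, hx0⟩ := exists_mem_map_ne_zero π hL
    obtain ⟨m, hm⟩ := mem_span_singleton.1 (hmem x hx)
    intro h0
    rw [h0, smul_zero] at hm
    exact hx0 hm.symm
  obtain ⟨u, rfl⟩ := isUnit_of_map_ne_zero π hR (u := u₀) (by rwa [hu₀g'])
  -- `π(u⁻¹L) = g⁻¹π(L) = ℤ`
  have hint : ∀ x ∈ (u⁻¹ : Aˣ) • L, ∃ m : ℤ, (m : ℚ) = π x := fun x hx => by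
    rw [mem_units_smul_submodule_iff, inv_inv] at hx
    obtain ⟨m, hm⟩ := mem_span_singleton.1 (hmem _ hx)
    refine ⟨m, ?_⟩
    have e : π x = g⁻¹ * π (u • x) := by
      rw [Units.smul_def, smul_eq_mul, map_mul, hu₀g', inv_mul_cancel_left₀ hg0]
    rw [e, ← hm, zsmul_eq_mul, mul_comm (m : ℚ) g, inv_mul_cancel_left₀ hg0]
  refine ⟨u, hu₀, ?_, mul_le.2 fun x hx y hy => ?_⟩
  · rw [mem_units_smul_submodule_iff, inv_inv, Units.smul_def, smul_eq_mul, mul_one]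
    exact hu₀
  · obtain ⟨m, hm⟩ := hint x hx
    obtain ⟨m', hm'⟩ := hint y hy
    have h1 : (1 : A) ∈ (u⁻¹ : Aˣ) • L := by
      rw [mem_units_smul_submodule_iff, inv_inv, Units.smul_def, smul_eq_mul, mul_one]
      exact hu₀
    rw [mul_eq_of_map_eq π hR x y, ← hm, ← hm', Int.cast_smul_eq_zsmul, Int.cast_smul_eq_zsmul, ← Int.cast_mul,
      Int.cast_smul_eq_zsmul]
    exact Submodule.sub_mem _ (Submodule.add_mem _ (Submodule.smul_mem _ _ hx) (Submodule.smul_mem _ _ hy))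
      (Submodule.smul_mem _ _ h1)

omit [Algebra ℚ A] in
/-- **LEMMA 12.1: the order of `L` is `𝒪(L) = u⁻¹L`** for the unit `u` of `exists_units_mem_isOrder_inv_smul`
(`𝒪(uΛ) = 𝒪(Λ) = Λ`). [cite: HertlingLarabi2026b, §12 Lemma 12.1, chunk p0041] -/
theorem div_self_eq_inv_smul {L : Submodule ℤ A} {u : Aˣ} (h1 : (1 : A) ∈ u⁻¹ • L)
    (hmul : (u⁻¹ • L) * (u⁻¹ • L) ≤ u⁻¹ • L) : L / L = u⁻¹ • L := by
  conv_lhs => rw [← smul_inv_smul u L, div_self_units_smul]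
  exact div_self_eq_of_one_mem h1 hmul

/-- **LEMMA 12.1: «Each full lattice is invertible»** when `(ker π)² = 0` (`L = u·Λ` with `Λ = u⁻¹L` an order, and
orders are invertible). [cite: HertlingLarabi2026b, §12 Lemma 12.1, chunk p0041] -/
theorem mul_div_div_eq_of_sq_zero (π : A →ₐ[ℚ] ℚ) (hR : ∀ x y : A, π x = 0 → π y = 0 → x * y = 0)
    {L : Submodule ℤ A} (hL : IsFullLattice A L) : L * ((L / L) / L) = L / L := by
  obtain ⟨u, -, h1, hmul⟩ := exists_units_mem_isOrder_inv_smul π hR hL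
  have h := units_smul_mul_div_div_eq u (mul_div_div_eq_of_one_mem_of_mul_le h1 hmul)
  rwa [smul_inv_smul] at h

/-- **LEMMA 12.1: every full lattice is `ε`-EQUIVALENT TO ITS OWN ORDER, `L = u·𝒪(L)`** («`𝓔(A) = W(𝓔(A)) ≅
({orders}, ·)`»). [cite: HertlingLarabi2026b, §12 Lemma 12.1, chunk p0041] -/
theorem exists_units_smul_div_self_eq (π : A →ₐ[ℚ] ℚ) (hR : ∀ x y : A, π x = 0 → π y = 0 → x * y = 0)
    {L : Submodule ℤ A} (hL : IsFullLattice A L) : ∃ u : Aˣ, (u : A) ∈ L ∧ u • (L / L) = L := by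
  obtain ⟨u, hu, h1, hmul⟩ := exists_units_mem_isOrder_inv_smul π hR hL
  exact ⟨u, hu, by rw [div_self_eq_inv_smul h1 hmul, smul_inv_smul]⟩

/-! ## §4 The orders are `ℤ1_A ⊕ K`, `K ⊆ R`, and multiply by adding the `K`'s -/

/-- **LEMMA 12.1: «The orders are the full lattices `ℤ1_A ⊕ K` with `K ∈ 𝓛(R)`» — an order `Λ` equals
`ℤ1_A + (Λ ∩ ker π)`** (`x = π(x)1_A + (x − π(x)1_A)` with `π(x) ∈ ℤ`). [cite: HertlingLarabi2026b, §12 Lemma 12.1, chunk p0041] -/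
theorem eq_span_one_sup_inf_ker (π : A →ₐ[ℚ] ℚ) {Λ : Submodule ℤ A} (hΛ : Λ.FG) (h1 : (1 : A) ∈ Λ)
    (hΛΛ : Λ * Λ ≤ Λ) :
    Λ = span ℤ {(1 : A)} ⊔ (Λ ⊓ LinearMap.ker (π.toLinearMap.restrictScalars ℤ)) := by
  refine le_antisymm (fun x hx => ?_) (sup_le ((span_singleton_le_iff_mem _ _).2 h1) inf_le_left)
  obtain ⟨m, hm⟩ := exists_intCast_eq_map_of_one_mem π hΛ h1 hΛΛ hx
  have e : x = m • (1 : A) + (x - m • (1 : A)) := by abel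
  rw [e]
  refine Submodule.add_mem_sup (Submodule.smul_mem _ _ (mem_span_singleton_self _)) ⟨?_, ?_⟩
  · exact Submodule.sub_mem _ hx (Submodule.smul_mem _ _ h1)
  · change π (x - m • (1 : A)) = 0
    rw [map_sub, map_zsmul, map_one, zsmul_eq_mul, mul_one, ← hm, sub_self]

/-- **`(ℤ1_A + K)·(ℤ1_A + K′) = ℤ1_A + (K + K′)` for `K, K′ ⊆ ker π`** («`({orders}, ·) ≅ (𝓛(R), +)`»: `KK′ = 0`).
[cite: HertlingLarabi2026b, §12 Lemma 12.1, chunk p0041] -/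
theorem span_one_sup_mul_span_one_sup (π : A →ₐ[ℚ] ℚ) (hR : ∀ x y : A, π x = 0 → π y = 0 → x * y = 0)
    {K K' : Submodule ℤ A} (hK : ∀ x ∈ K, π x = 0) (hK' : ∀ x ∈ K', π x = 0) :
    (span ℤ {(1 : A)} ⊔ K) * (span ℤ {(1 : A)} ⊔ K') = span ℤ {(1 : A)} ⊔ (K ⊔ K') := by
  have h11 : span ℤ {(1 : A)} * span ℤ {(1 : A)} = span ℤ {(1 : A)} := by
    rw [span_mul_span, Set.singleton_mul_singleton, mul_one]
  have h1K : ∀ P : Submodule ℤ A, span ℤ {(1 : A)} * P = P := fun P => by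
    rw [← Submodule.one_eq_span, one_mul]
  have hK1 : ∀ P : Submodule ℤ A, P * span ℤ {(1 : A)} = P := fun P => by
    rw [mul_comm, h1K]
  have hKK' : K * K' = ⊥ := by
    rw [eq_bot_iff, mul_le]
    intro x hx y hy
    rw [hR x y (hK x hx) (hK' y hy)]
    exact Submodule.zero_mem _
  rw [Submodule.mul_sup, Submodule.sup_mul, Submodule.sup_mul, h11, hK1, h1K, hKK', sup_bot_eq, sup_assoc]

/-- **Every `ℤ1_A + K` with `K ⊆ ker π` is multiplicatively closed and contains `1_A`** (it is an order as soon as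
it is a full lattice). [cite: HertlingLarabi2026b, §12 Lemma 12.1, chunk p0041] -/
theorem isOrder_span_one_sup (π : A →ₐ[ℚ] ℚ) (hR : ∀ x y : A, π x = 0 → π y = 0 → x * y = 0)
    {K : Submodule ℤ A} (hK : ∀ x ∈ K, π x = 0) :
    (1 : A) ∈ span ℤ {(1 : A)} ⊔ K ∧
      (span ℤ {(1 : A)} ⊔ K) * (span ℤ {(1 : A)} ⊔ K) ≤ span ℤ {(1 : A)} ⊔ K := by
  refine ⟨Submodule.mem_sup_left (mem_span_singleton_self _), le_of_eq ?_⟩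
  rw [span_one_sup_mul_span_one_sup π hR hK hK, sup_idem]

omit [Algebra ℚ A] in
/-- **`ε`-equivalent orders are EQUAL** («`𝓔(A) ≅ ({orders}, ·)`»: `uΛ = Λ′` with `1 ∈ Λ′` forces `u⁻¹ ∈ Λ`… here
directly: `Λ = 𝒪(Λ) = 𝒪(uΛ) = 𝒪(Λ′) = Λ′`). [cite: HertlingLarabi2026b, §12 Lemma 12.1, chunk p0041] [cite: HertlingLarabi2026, §6 (6.1) («orders with `[Λ_1]_ε = [Λ_2]_ε` ⟹ `Λ_1 = Λ_2`»), chunk p0015] -/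
theorem eq_of_units_smul_eq_of_isOrder {Λ Λ' : Submodule ℤ A} {u : Aˣ} (h : u • Λ = Λ')
    (h1 : (1 : A) ∈ Λ) (hΛΛ : Λ * Λ ≤ Λ) (h1' : (1 : A) ∈ Λ') (hΛ'Λ' : Λ' * Λ' ≤ Λ') : Λ = Λ' := by
  rw [← div_self_eq_of_one_mem h1 hΛΛ, ← div_self_eq_of_one_mem h1' hΛ'Λ', ← h, div_self_units_smul]

/-! ## §5 The model `TrivSqZeroExt ℚ M = ℚ1 ⊕ M`, `M·M = 0` -/

section TrivSqZeroExt

variable {M : Type} [AddCommGroup M] [Module ℚ M] [Module ℚᵐᵒᵖ M] [IsCentralScalar ℚ M]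

omit [IsCentralScalar ℚ M] in
/-- In `TrivSqZeroExt ℚ M` the kernel of `fst` has square zero: the hypothesis of §§1–4 for `π = fstHom`.
[cite: HertlingLarabi2026b, §12 Lemma 12.1 («`a² = ab = b² = 0`»), chunk p0041] -/
theorem trivSqZeroExt_mul_eq_zero_of_fst_eq_zero (x y : TrivSqZeroExt ℚ M) (hx : x.fst = 0) (hy : y.fst = 0) :
    x * y = 0 := by
  have ex : x = TrivSqZeroExt.inr x.snd := TrivSqZeroExt.ext (by simpa using hx) (by simp)
  have ey : y = TrivSqZeroExt.inr y.snd := TrivSqZeroExt.ext (by simpa using hy) (by simp)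
  rw [ex, ey, TrivSqZeroExt.inr_mul_inr]

/-- **LEMMA 12.1 for `A = ℚ1 ⊕ M` (`M·M = 0`): every full lattice contains a unit `u` with `u⁻¹L` an order** — for
`M = ℚ²` this is HL's `ℚ[x,y]/(x²,xy,y²)`. [cite: HertlingLarabi2026b, §12 Lemma 12.1, chunk p0041] -/
theorem exists_units_mem_isOrder_inv_smul_trivSqZeroExt {L : Submodule ℤ (TrivSqZeroExt ℚ M)}
    (hL : IsFullLattice (TrivSqZeroExt ℚ M) L) :
    ∃ u : (TrivSqZeroExt ℚ M)ˣ, (u : TrivSqZeroExt ℚ M) ∈ L ∧ (1 : TrivSqZeroExt ℚ M) ∈ u⁻¹ • L ∧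
      (u⁻¹ • L) * (u⁻¹ • L) ≤ u⁻¹ • L :=
  exists_units_mem_isOrder_inv_smul (TrivSqZeroExt.fstHom ℚ ℚ M)
    (fun x y hx hy => trivSqZeroExt_mul_eq_zero_of_fst_eq_zero x y hx hy) hL

/-- **LEMMA 12.1 for `A = ℚ1 ⊕ M` (`M·M = 0`): every full lattice is invertible.**
[cite: HertlingLarabi2026b, §12 Lemma 12.1, chunk p0041] -/
theorem mul_div_div_eq_trivSqZeroExt {L : Submodule ℤ (TrivSqZeroExt ℚ M)}
    (hL : IsFullLattice (TrivSqZeroExt ℚ M) L) : L * ((L / L) / L) = L / L :=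
  mul_div_div_eq_of_sq_zero (TrivSqZeroExt.fstHom ℚ ℚ M)
    (fun x y hx hy => trivSqZeroExt_mul_eq_zero_of_fst_eq_zero x y hx hy) hL

end TrivSqZeroExt

end SquareZeroRadical

end Literature.NumberTheory.ComplexMultiplication.FiniteQAlgebraLattice
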